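import Summits.Ventures.PercRepro.C041RelaxedTriangleCone

/-!
# THE TRIANGLE ON EVERY PAIR OF MARKED VERTICES WITH ≤ 2 MARKS IS IN THE CONE — explicit certificates
(mine-3, gen 59; C-041.md §21 (d), (u), (z))

For two marked vertices `X(p, q) = v 1 ^ p * v 0 ^ q` at the exits of the triangle, cone membership of `θ_△` is known
when the mixed-type defect vanishes (`α = β`: `thetaTri_InCone_of_alpha_eq_beta` — marks of one common type, single
marks) and for `X(1,1) × X(1,1)` (`thetaTri_X11_X11`).  This module settles EVERY remaining pair with `p + q ≤ 2` and
`p′ + q′ ≤ 2` by an explicit rational certificate found with the lane's exact LP on the generator atoms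
`{0, 1, ½, ⅓, ⅔}` (mining/mine-3/tools/g59/markscert59.py) and checked here as an identity of six-vectors
(`thetaTri_eq_vec` + `norm_num`): `X(1,1) × X(1,0)`, `X(1,1) × X(0,1)`, `X(1,1) × X(2,0)`, `X(1,1) × X(0,2)`,
`X(2,0) × X(0,1)`, `X(1,0) × X(0,2)`, `X(2,0) × X(0,2)` — e.g. `θ_△(X(2,0), X(0,2)) = 16·X(1,1) + 8·v 0 + 8·v 1 + 3·1`.
With the cycle reduction of `C041CycleArcModel` every two-exit cycle carrying two such vertices lies in the cone.
-/

namespace PercRepro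

namespace RelaxedTriangle

open TreeClosure

/-- `θ_△(X(1,1), X(1,0)) = 9·v(2/3) + 9/2·v(1)∘v(1/3) + 4·v(1)∘v(1/2) + 1·v(0) + 1·v(0)∘v(1) + 1/2·v(1)` (exact; `α = 1`, `β = 0`). -/
theorem thetaTri_X11_X10 : thetaTri (v 1 * v 0) (v 1) = (9 : ℝ) • v (2/3) + (9/2 : ℝ) • (v 1 * v (1/3)) + (4 : ℝ) • (v 1 * v (1/2)) + (1 : ℝ) • v 0 + (1 : ℝ) • (v 0 * v 1) + (1/2 : ℝ) • v 1 := by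
  ext i
  simp only [thetaTri_eq_vec, Pi.add_apply, Pi.smul_apply, Pi.mul_apply, smul_eq_mul, v]
  fin_cases i <;> simp <;> norm_num

/-- The triangle with the marked vertices `X(1,1)`, `X(1,0)` lies in the cone. -/
theorem InCone_thetaTri_X11_X10 : InCone (thetaTri (v 1 * v 0) (v 1)) := by
  rw [thetaTri_X11_X10]
  exact ((((((InCone.smul _ (by norm_num) (InCone_v (2/3) ⟨by norm_num, by norm_num⟩)).add (InCone.smul _ (by norm_num) ((InCone_v 1 ⟨zero_le_one, le_rfl⟩).mul (InCone_v (1/3) ⟨by norm_num, by norm_num⟩)))).add (InCone.smul _ (by norm_num) ((InCone_v 1 ⟨zero_le_one, le_rfl⟩).mul (InCone_v (1/2) ⟨by norm_num, by norm_num⟩)))).add (InCone.smul _ (by norm_num) (InCone_v 0 ⟨le_rfl, zero_le_one⟩))).add (InCone.smul _ (by norm_num) ((InCone_v 0 ⟨le_rfl, zero_le_one⟩).mul (InCone_v 1 ⟨zero_le_one, le_rfl⟩)))).add (InCone.smul _ (by norm_num) (InCone_v 1 ⟨zero_le_one, le_rfl⟩)))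

/-- `θ_△(X(1,1), X(0,1)) = 8·v(1/2) + 9/2·v(0)∘v(2/3) + 4·v(0)∘v(1/2) + 5/2·v(0) + 1·v(0)∘v(1)` (exact; `α = 1`, `β = 0`). -/
theorem thetaTri_X11_X01 : thetaTri (v 1 * v 0) (v 0) = (8 : ℝ) • v (1/2) + (9/2 : ℝ) • (v 0 * v (2/3)) + (4 : ℝ) • (v 0 * v (1/2)) + (5/2 : ℝ) • v 0 + (1 : ℝ) • (v 0 * v 1) := by
  ext i
  simp only [thetaTri_eq_vec, Pi.add_apply, Pi.smul_apply, Pi.mul_apply, smul_eq_mul, v]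
  fin_cases i <;> simp <;> norm_num

/-- The triangle with the marked vertices `X(1,1)`, `X(0,1)` lies in the cone. -/
theorem InCone_thetaTri_X11_X01 : InCone (thetaTri (v 1 * v 0) (v 0)) := by
  rw [thetaTri_X11_X01]
  exact (((((InCone.smul _ (by norm_num) (InCone_v (1/2) ⟨by norm_num, by norm_num⟩)).add (InCone.smul _ (by norm_num) ((InCone_v 0 ⟨le_rfl, zero_le_one⟩).mul (InCone_v (2/3) ⟨by norm_num, by norm_num⟩)))).add (InCone.smul _ (by norm_num) ((InCone_v 0 ⟨le_rfl, zero_le_one⟩).mul (InCone_v (1/2) ⟨by norm_num, by norm_num⟩)))).add (InCone.smul _ (by norm_num) (InCone_v 0 ⟨le_rfl, zero_le_one⟩))).add (InCone.smul _ (by norm_num) ((InCone_v 0 ⟨le_rfl, zero_le_one⟩).mul (InCone_v 1 ⟨zero_le_one, le_rfl⟩))))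

/-- `θ_△(X(1,1), X(2,0)) = 16·v(1)∘v(1/2) + 9·v(2/3) + 7/2·v(1)∘v(1) + 2·v(0)∘v(1) + 1·v(0) + 1/2·v(1)` (exact; `α = 3`, `β = 0`). -/
theorem thetaTri_X11_X20 : thetaTri (v 1 * v 0) (v 1 * v 1) = (16 : ℝ) • (v 1 * v (1/2)) + (9 : ℝ) • v (2/3) + (7/2 : ℝ) • (v 1 * v 1) + (2 : ℝ) • (v 0 * v 1) + (1 : ℝ) • v 0 + (1/2 : ℝ) • v 1 := by
  ext i
  simp only [thetaTri_eq_vec, Pi.add_apply, Pi.smul_apply, Pi.mul_apply, smul_eq_mul, v]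
  fin_cases i <;> simp <;> norm_num

/-- The triangle with the marked vertices `X(1,1)`, `X(2,0)` lies in the cone. -/
theorem InCone_thetaTri_X11_X20 : InCone (thetaTri (v 1 * v 0) (v 1 * v 1)) := by
  rw [thetaTri_X11_X20]
  exact ((((((InCone.smul _ (by norm_num) ((InCone_v 1 ⟨zero_le_one, le_rfl⟩).mul (InCone_v (1/2) ⟨by norm_num, by norm_num⟩))).add (InCone.smul _ (by norm_num) (InCone_v (2/3) ⟨by norm_num, by norm_num⟩))).add (InCone.smul _ (by norm_num) ((InCone_v 1 ⟨zero_le_one, le_rfl⟩).mul (InCone_v 1 ⟨zero_le_one, le_rfl⟩)))).add (InCone.smul _ (by norm_num) ((InCone_v 0 ⟨le_rfl, zero_le_one⟩).mul (InCone_v 1 ⟨zero_le_one, le_rfl⟩)))).add (InCone.smul _ (by norm_num) (InCone_v 0 ⟨le_rfl, zero_le_one⟩))).add (InCone.smul _ (by norm_num) (InCone_v 1 ⟨zero_le_one, le_rfl⟩)))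

/-- `θ_△(X(1,1), X(0,2)) = 16·v(0)∘v(1/2) + 8·v(1/2) + 7/2·v(0)∘v(0) + 5/2·v(0) + 2·v(0)∘v(1)` (exact; `α = 3`, `β = 0`). -/
theorem thetaTri_X11_X02 : thetaTri (v 1 * v 0) (v 0 * v 0) = (16 : ℝ) • (v 0 * v (1/2)) + (8 : ℝ) • v (1/2) + (7/2 : ℝ) • (v 0 * v 0) + (5/2 : ℝ) • v 0 + (2 : ℝ) • (v 0 * v 1) := by
  ext i
  simp only [thetaTri_eq_vec, Pi.add_apply, Pi.smul_apply, Pi.mul_apply, smul_eq_mul, v]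
  fin_cases i <;> simp <;> norm_num

/-- The triangle with the marked vertices `X(1,1)`, `X(0,2)` lies in the cone. -/
theorem InCone_thetaTri_X11_X02 : InCone (thetaTri (v 1 * v 0) (v 0 * v 0)) := by
  rw [thetaTri_X11_X02]
  exact (((((InCone.smul _ (by norm_num) ((InCone_v 0 ⟨le_rfl, zero_le_one⟩).mul (InCone_v (1/2) ⟨by norm_num, by norm_num⟩))).add (InCone.smul _ (by norm_num) (InCone_v (1/2) ⟨by norm_num, by norm_num⟩))).add (InCone.smul _ (by norm_num) ((InCone_v 0 ⟨le_rfl, zero_le_one⟩).mul (InCone_v 0 ⟨le_rfl, zero_le_one⟩)))).add (InCone.smul _ (by norm_num) (InCone_v 0 ⟨le_rfl, zero_le_one⟩))).add (InCone.smul _ (by norm_num) ((InCone_v 0 ⟨le_rfl, zero_le_one⟩).mul (InCone_v 1 ⟨zero_le_one, le_rfl⟩))))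

/-- `θ_△(X(2,0), X(0,1)) = 27/4·v(2/3) + 6·v(1/2) + 4·v(1)∘v(1/2) + 3·v(0)∘v(1) + 7/4·v(0) + 3/2·v(1)∘v(1)` (exact; `α = 3`, `β = 1`). -/
theorem thetaTri_X20_X01 : thetaTri (v 1 * v 1) (v 0) = (27/4 : ℝ) • v (2/3) + (6 : ℝ) • v (1/2) + (4 : ℝ) • (v 1 * v (1/2)) + (3 : ℝ) • (v 0 * v 1) + (7/4 : ℝ) • v 0 + (3/2 : ℝ) • (v 1 * v 1) := by
  ext i
  simp only [thetaTri_eq_vec, Pi.add_apply, Pi.smul_apply, Pi.mul_apply, smul_eq_mul, v]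
  fin_cases i <;> simp <;> norm_num

/-- The triangle with the marked vertices `X(2,0)`, `X(0,1)` lies in the cone. -/
theorem InCone_thetaTri_X20_X01 : InCone (thetaTri (v 1 * v 1) (v 0)) := by
  rw [thetaTri_X20_X01]
  exact ((((((InCone.smul _ (by norm_num) (InCone_v (2/3) ⟨by norm_num, by norm_num⟩)).add (InCone.smul _ (by norm_num) (InCone_v (1/2) ⟨by norm_num, by norm_num⟩))).add (InCone.smul _ (by norm_num) ((InCone_v 1 ⟨zero_le_one, le_rfl⟩).mul (InCone_v (1/2) ⟨by norm_num, by norm_num⟩)))).add (InCone.smul _ (by norm_num) ((InCone_v 0 ⟨le_rfl, zero_le_one⟩).mul (InCone_v 1 ⟨zero_le_one, le_rfl⟩)))).add (InCone.smul _ (by norm_num) (InCone_v 0 ⟨le_rfl, zero_le_one⟩))).add (InCone.smul _ (by norm_num) ((InCone_v 1 ⟨zero_le_one, le_rfl⟩).mul (InCone_v 1 ⟨zero_le_one, le_rfl⟩))))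

/-- `θ_△(X(1,0), X(0,2)) = 8·v(1/2) + 9/2·v(2/3) + 4·v(0)∘v(1/2) + 3·v(0)∘v(1) + 2·v(0) + 3/2·v(0)∘v(0)` (exact; `α = 3`, `β = 1`). -/
theorem thetaTri_X10_X02 : thetaTri (v 1) (v 0 * v 0) = (8 : ℝ) • v (1/2) + (9/2 : ℝ) • v (2/3) + (4 : ℝ) • (v 0 * v (1/2)) + (3 : ℝ) • (v 0 * v 1) + (2 : ℝ) • v 0 + (3/2 : ℝ) • (v 0 * v 0) := by
  ext i
  simp only [thetaTri_eq_vec, Pi.add_apply, Pi.smul_apply, Pi.mul_apply, smul_eq_mul, v]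
  fin_cases i <;> simp <;> norm_num

/-- The triangle with the marked vertices `X(1,0)`, `X(0,2)` lies in the cone. -/
theorem InCone_thetaTri_X10_X02 : InCone (thetaTri (v 1) (v 0 * v 0)) := by
  rw [thetaTri_X10_X02]
  exact ((((((InCone.smul _ (by norm_num) (InCone_v (1/2) ⟨by norm_num, by norm_num⟩)).add (InCone.smul _ (by norm_num) (InCone_v (2/3) ⟨by norm_num, by norm_num⟩))).add (InCone.smul _ (by norm_num) ((InCone_v 0 ⟨le_rfl, zero_le_one⟩).mul (InCone_v (1/2) ⟨by norm_num, by norm_num⟩)))).add (InCone.smul _ (by norm_num) ((InCone_v 0 ⟨le_rfl, zero_le_one⟩).mul (InCone_v 1 ⟨zero_le_one, le_rfl⟩)))).add (InCone.smul _ (by norm_num) (InCone_v 0 ⟨le_rfl, zero_le_one⟩))).add (InCone.smul _ (by norm_num) ((InCone_v 0 ⟨le_rfl, zero_le_one⟩).mul (InCone_v 0 ⟨le_rfl, zero_le_one⟩))))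

/-- `θ_△(X(2,0), X(0,2)) = 16·v(0)∘v(1) + 8·v(0) + 8·v(1) + 3·𝟙` (exact; `α = 9`, `β = 1`). -/
theorem thetaTri_X20_X02 : thetaTri (v 1 * v 1) (v 0 * v 0) = (16 : ℝ) • (v 0 * v 1) + (8 : ℝ) • v 0 + (8 : ℝ) • v 1 + (3 : ℝ) • (1 : Vec6) := by
  ext i
  simp only [thetaTri_eq_vec, Pi.add_apply, Pi.smul_apply, Pi.mul_apply, Pi.one_apply, smul_eq_mul, v]
  fin_cases i <;> simp <;> norm_num

/-- The triangle with the marked vertices `X(2,0)`, `X(0,2)` lies in the cone. -/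
theorem InCone_thetaTri_X20_X02 : InCone (thetaTri (v 1 * v 1) (v 0 * v 0)) := by
  rw [thetaTri_X20_X02]
  exact ((((InCone.smul _ (by norm_num) ((InCone_v 0 ⟨le_rfl, zero_le_one⟩).mul (InCone_v 1 ⟨zero_le_one, le_rfl⟩))).add (InCone.smul _ (by norm_num) (InCone_v 0 ⟨le_rfl, zero_le_one⟩))).add (InCone.smul _ (by norm_num) (InCone_v 1 ⟨zero_le_one, le_rfl⟩))).add (InCone.smul _ (by norm_num) InCone_one))

end RelaxedTriangle

end PercRepro
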